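import Mathlib
import Literature.NumberTheory.LFunctions.WeilExplicit
import Literature.NumberTheory.LFunctions.WeilExplicitProofs
import Literature.NumberTheory.LFunctions.WeilMarkovQuadratic
import Literature.NumberTheory.LFunctions.WeilArchimedeanPositivityProofs
import Literature.NumberTheory.LFunctions.WeilGroundStateRealZerosProofs
import HarnessLib

/-!
# Crux `GroundStateSimpleEven` (stmt-RiemannHypothesis-1526), line `parity-multiplicity-commutator`,
# stub (PC1) `stub_pairContinuity_polarPrime`: pair continuity, polar and prime part

Support file (`--supports stmt-RiemannHypothesis-1526`).  Normalisation of
`Literature/NumberTheory/LFunctions/WeilExplicit.lean`: `W = weilFunctional =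
weilPolarTerm − weilPrimeTerm + weilArchTerm`, `⋆ = weilConv`, `h̃ = weilReflect h`,
`ĝ = weilMellin g`.

**Statement** (`stub_pairContinuity_polarPrime`).  For `a > 0` there is `C ≥ 0` such that for all
test functions `f, h` supported in the window `[-a, a]`, the kernel `K = f ⋆ h̃` satisfies
`‖K̂(0) + K̂(1)‖ + ‖Σₙ Λ(n) n^{-1/2} (K(log n) + K(−log n))‖ + ‖K(0)‖ ≤ C ‖f‖₂ ‖h‖₂`.

**Proof.**
* `K(t) = ∫ f(u) conj h(u − t) du`, so `sup_t ‖K(t)‖ ≤ ‖f‖₂ ‖h‖₂` (Cauchy–Schwarz and translation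
  invariance; `polarPrime_norm_weilConv_weilReflect_le`), in particular `‖K(0)‖ ≤ ‖f‖₂ ‖h‖₂`.
* `tsupport K ⊆ tsupport f + tsupport h̃ ⊆ [-2a, 2a]`, so only the prime powers `n ≤ e^{2a}` enter
  and `‖prime term‖ ≤ 2 ‖f‖₂‖h‖₂ Σ_{n ≤ e^{2a}} Λ(n)/√n` (Bombieri 2000 §4 Lemma 3,
  `norm_weilPrimeTerm_le_of_tsupport_subset`).
* `K̂ = f̂ · (h̃)^` (`weilMellin_weilConv_holds`) and `‖ĝ(s)‖ ≤ E_s(a) ‖g‖₂` for `g ∈ L²`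
  vanishing off `[-a, a]` (`ConnesVanSuijlekom.norm_weilMellin_le_of_ae_eq_zero`), applied to `f`
  and to `h̃` (`‖h̃‖₂ = ‖h‖₂`), whence `‖K̂(0) + K̂(1)‖ ≤ (E₀² + E₁²) ‖f‖₂ ‖h‖₂`.

Mathlib + proved tree files only; no named fact; no definitions.
-/

noncomputable section

open Set MeasureTheory Filter Complex
open scoped Real Topology ComplexConjugate ArithmeticFunction.vonMangoldt

namespace Summit.RiemannHypothesis.RiemannHypothesis.Theorems.GroundStateSimpleEven

open Literature.NumberTheory.LFunctions

-- `linter.dupNamespace` off: the mandated namespace `Summit.RiemannHypothesis.RiemannHypothesis.…`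
-- (single-problem summit) repeats a component.
set_option linter.dupNamespace false

section PolarPrime

variable {a : ℝ} {f h : ℝ → ℂ}

/-- If `tsupport h ⊆ [-a, a]` then `tsupport h̃ ⊆ [-a, a]` (`tsupport h̃ = −tsupport h`).
[folklore] -/
theorem polarPrime_tsupport_weilReflect_subset (hhs : tsupport h ⊆ Icc (-a) a) :
    tsupport (weilReflect h) ⊆ Icc (-a) a := by
  rw [tsupport_weilReflect]
  intro x hx
  have h1 : -x ∈ Icc (-a) a := hhs (Set.mem_neg.mp hx)
  simp only [mem_Icc] at h1 ⊢
  constructor <;> linarith [h1.1, h1.2]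

/-- `‖h̃‖₂ = ‖h‖₂`: `∫ ‖h̃‖² = ∫ ‖h‖²` (reflection invariance of Lebesgue measure). [folklore] -/
theorem polarPrime_integral_norm_sq_weilReflect (h : ℝ → ℂ) :
    ∫ t, ‖weilReflect h t‖ ^ 2 = ∫ t, ‖h t‖ ^ 2 := by
  simp only [weilReflect, Complex.norm_conj]
  exact integral_neg_eq_self (fun t : ℝ ↦ ‖h t‖ ^ 2) volume

/-- **Pointwise Cauchy–Schwarz for the polarised kernel**: for test functions `f, h` and every `t`,
`‖(f ⋆ h̃)(t)‖ ≤ ‖f‖₂ ‖h‖₂`, since `(f ⋆ h̃)(t) = ∫ f(u) conj h(u − t) du` and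
`∫ ‖h(u − t)‖² du = ‖h‖₂²` (Bombieri 2000 §4 Lemma 2, polarised). [folklore] -/
theorem polarPrime_norm_weilConv_weilReflect_le (hf : IsWeilTest f) (hh : IsWeilTest h) (t : ℝ) :
    ‖weilConv f (weilReflect h) t‖ ≤ √(∫ x, ‖f x‖ ^ 2) * √(∫ x, ‖h x‖ ^ 2) := by
  have hk : weilConv f (weilReflect h) t = ∫ u : ℝ, f u * conj (h (u - t)) := by
    rw [weilConv_apply]
    congr 1 with u
    simp [weilReflect, neg_sub]
  have hv : MemLp (fun u ↦ h (u - t)) 2 :=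
    (hh.1.continuous.comp (continuous_sub_right t)).memLp_of_hasCompactSupport
      (hh.2.comp_homeomorph (Homeomorph.subRight t))
  have h0 := ConnesVanSuijlekom.norm_integral_mul_conj_sub_le
    (ConnesVanSuijlekom.isWeilTest_memLp hf) hv (MemLp.zero' (p := 2) (μ := volume))
  simp only [map_zero, mul_zero, integral_zero, sub_zero] at h0
  rw [hk]
  refine h0.trans_eq ?_
  rw [integral_sub_right_eq_self (fun u : ℝ ↦ ‖h u‖ ^ 2) t]

/-- **`L²`-continuity of `f ↦ f̂(s)` on the window, constant form**: for every `a` and `s` there is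
`E ≥ 0` with `‖f̂(s)‖ ≤ E ‖f‖₂` for every test function `f` supported in `[-a, a]`
(`E = (∫_{[-a,a]} |e^{(s−1/2)t}|² dt)^{1/2}`, Cauchy–Schwarz on the window). [folklore] -/
theorem polarPrime_exists_norm_weilMellin_le (a : ℝ) (s : ℂ) :
    ∃ E : ℝ, 0 ≤ E ∧ ∀ f : ℝ → ℂ, IsWeilTest f → tsupport f ⊆ Icc (-a) a →
      ‖weilMellin f s‖ ≤ E * √(∫ t, ‖f t‖ ^ 2) :=
  ⟨√(∫ t in Icc (-a) a, ‖cexp ((s - 1 / 2) * t)‖ ^ 2), Real.sqrt_nonneg _, fun _ hf hfs ↦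
    ConnesVanSuijlekom.norm_weilMellin_le_of_ae_eq_zero (ConnesVanSuijlekom.isWeilTest_memLp hf)
      (Eventually.of_forall fun _ ht ↦ eq_zero_of_tsupport_subset hfs ht) s⟩

/-- **Pair continuity, polar and prime part.** For every `a` there is `C ≥ 0` such that for all
window test functions `f, h`, with `K = f ⋆ h̃`:
`‖K̂(0) + K̂(1)‖ + ‖Σₙ Λ(n) n^{-1/2}(K(log n) + K(−log n))‖ + ‖K(0)‖ ≤ C ‖f‖₂ ‖h‖₂`
(`sup ‖K‖ ≤ ‖f‖₂‖h‖₂`, `tsupport K ⊆ [-2a, 2a]` so finitely many prime powers enter,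
`K̂ = f̂ · (h̃)^` with `‖ĝ(σ)‖ ≤ E_σ ‖g‖₂` on the window; Bombieri 2000 §4 Lemmas 2–3,
polarised). [folklore] -/
theorem polarPrime_bound (a : ℝ) :
    ∃ C : ℝ, 0 ≤ C ∧ ∀ f h : ℝ → ℂ, IsWeilTest f → tsupport f ⊆ Icc (-a) a →
      IsWeilTest h → tsupport h ⊆ Icc (-a) a →
        ‖weilPolarTerm (weilConv f (weilReflect h))‖ +
            ‖weilPrimeTerm (weilConv f (weilReflect h))‖ + ‖weilConv f (weilReflect h) 0‖ ≤
          C * √(∫ t, ‖f t‖ ^ 2) * √(∫ t, ‖h t‖ ^ 2) := by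
  obtain ⟨E0, hE0, hM0⟩ := polarPrime_exists_norm_weilMellin_le a 0
  obtain ⟨E1, hE1, hM1⟩ := polarPrime_exists_norm_weilMellin_le a 1
  set P : ℝ := ∑ n ∈ Finset.range (⌊Real.exp (2 * a)⌋₊ + 1), (Λ n : ℝ) / Real.sqrt n with hPdef
  have hP : 0 ≤ P := Finset.sum_nonneg fun n _ ↦
    div_nonneg ArithmeticFunction.vonMangoldt_nonneg (Real.sqrt_nonneg _)
  refine ⟨E0 * E0 + E1 * E1 + 2 * P + 1, by positivity, fun f h hf hfs hh hhs ↦ ?_⟩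
  set Nf : ℝ := √(∫ t, ‖f t‖ ^ 2) with hNf
  set Nh : ℝ := √(∫ t, ‖h t‖ ^ 2) with hNh
  have hNf0 : 0 ≤ Nf := Real.sqrt_nonneg _
  have hNh0 : 0 ≤ Nh := Real.sqrt_nonneg _
  set K : ℝ → ℂ := weilConv f (weilReflect h) with hK
  have hR : IsWeilTest (weilReflect h) := hh.weilReflect
  have hRs : tsupport (weilReflect h) ⊆ Icc (-a) a := polarPrime_tsupport_weilReflect_subset hhs
  have hKt : IsWeilTest K := hf.weilConv hR
  have hKs : tsupport K ⊆ Icc (-(2 * a)) (2 * a) := by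
    refine (tsupport_weilConv_subset (h := weilReflect h) hf.2).trans ?_
    rintro x ⟨u, hu, v, hv, rfl⟩
    have hu' := hfs hu
    have hv' := hRs hv
    simp only [mem_Icc] at hu' hv' ⊢
    constructor <;> linarith [hu'.1, hu'.2, hv'.1, hv'.2]
  -- the pointwise bound `‖K x‖ ≤ ‖f‖₂ ‖h‖₂`
  have hKx : ∀ x, ‖K x‖ ≤ Nf * Nh := fun x ↦ polarPrime_norm_weilConv_weilReflect_le hf hh x
  -- the `L²`-norm of `h̃`
  have hNR : √(∫ t, ‖weilReflect h t‖ ^ 2) = Nh := by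
    rw [polarPrime_integral_norm_sq_weilReflect]
  -- polar term: `K̂ = f̂ · (h̃)^`
  have hMK : ∀ s, weilMellin K s = weilMellin f s * weilMellin (weilReflect h) s :=
    weilMellin_weilConv_holds hf.1.continuous hf.2 hR.1.continuous hR.2
  have hf0 : ‖weilMellin f 0‖ ≤ E0 * Nf := hM0 f hf hfs
  have hf1 : ‖weilMellin f 1‖ ≤ E1 * Nf := hM1 f hf hfs
  have hR0 : ‖weilMellin (weilReflect h) 0‖ ≤ E0 * Nh := by
    have h0 := hM0 (weilReflect h) hR hRs
    rwa [hNR] at h0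
  have hR1 : ‖weilMellin (weilReflect h) 1‖ ≤ E1 * Nh := by
    have h1 := hM1 (weilReflect h) hR hRs
    rwa [hNR] at h1
  have hPol : ‖weilPolarTerm K‖ ≤ (E0 * E0 + E1 * E1) * (Nf * Nh) := by
    rw [weilPolarTerm, hMK, hMK]
    calc ‖weilMellin f 0 * weilMellin (weilReflect h) 0 +
          weilMellin f 1 * weilMellin (weilReflect h) 1‖
        ≤ ‖weilMellin f 0‖ * ‖weilMellin (weilReflect h) 0‖ +
            ‖weilMellin f 1‖ * ‖weilMellin (weilReflect h) 1‖ :=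
          (norm_add_le _ _).trans_eq (by rw [norm_mul, norm_mul])
      _ ≤ E0 * Nf * (E0 * Nh) + E1 * Nf * (E1 * Nh) :=
          add_le_add (mul_le_mul hf0 hR0 (norm_nonneg _) (by positivity))
            (mul_le_mul hf1 hR1 (norm_nonneg _) (by positivity))
      _ = (E0 * E0 + E1 * E1) * (Nf * Nh) := by ring
  -- prime term: only `n ≤ e^{2a}` enter
  have hPr : ‖weilPrimeTerm K‖ ≤ 2 * (Nf * Nh) * P :=
    norm_weilPrimeTerm_le_of_tsupport_subset hKt.1.continuous hKs hKx
  -- point value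
  have hK0 : ‖K 0‖ ≤ Nf * Nh := hKx 0
  -- assembly
  calc ‖weilPolarTerm K‖ + ‖weilPrimeTerm K‖ + ‖K 0‖
      ≤ (E0 * E0 + E1 * E1) * (Nf * Nh) + 2 * (Nf * Nh) * P + Nf * Nh :=
        add_le_add (add_le_add hPol hPr) hK0
    _ = (E0 * E0 + E1 * E1 + 2 * P + 1) * Nf * Nh := by ring

end PolarPrime

end Summit.RiemannHypothesis.RiemannHypothesis.Theorems.GroundStateSimpleEven

namespace Summit.RiemannHypothesis.RiemannHypothesis.Theorems

open Literature.NumberTheory.LFunctions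

set_option linter.dupNamespace false in
/-- **Registered stub (PC1) of line `parity-multiplicity-commutator`: pair continuity, polar and
prime part.** For `a > 0` there is `C ≥ 0` such that for all test functions `f, h` supported in
`[-a, a]` the kernel `K = f ⋆ h̃` satisfies
`‖K̂(0) + K̂(1)‖ + ‖Σₙ Λ(n) n^{-1/2}(K(log n) + K(−log n))‖ + ‖K(0)‖ ≤ C ‖f‖₂ ‖h‖₂`
(`GroundStateSimpleEven.polarPrime_bound`; Bombieri 2000 §4 Lemmas 2–3, polarised). [folklore] -/
theorem stub_pairContinuity_polarPrime :
    ∀ a : ℝ, 0 < a → ∃ C : ℝ, 0 ≤ C ∧ ∀ f h : ℝ → ℂ, IsWeilTest f → tsupport f ⊆ Icc (-a) a →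
      IsWeilTest h → tsupport h ⊆ Icc (-a) a →
        ‖weilPolarTerm (weilConv f (weilReflect h))‖ +
            ‖weilPrimeTerm (weilConv f (weilReflect h))‖ + ‖weilConv f (weilReflect h) 0‖ ≤
          C * √(∫ t, ‖f t‖ ^ 2) * √(∫ t, ‖h t‖ ^ 2) :=
  fun a _ => GroundStateSimpleEven.polarPrime_bound a

end Summit.RiemannHypothesis.RiemannHypothesis.Theorems

end
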